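import Literature.Algebra.Homology.HomComplexOfModule
import Mathlib.Algebra.Module.Projective
import Mathlib.RingTheory.Ideal.Cotangent
import Mathlib.RingTheory.LocalRing.ResidueField.Basic
import Mathlib.LinearAlgebra.Dual.Lemmas
import Mathlib.LinearAlgebra.Isomorphisms
import Mathlib.Algebra.Homology.ShortComplex.ModuleCat
import Mathlib.Algebra.Homology.ShortComplex.HomologicalComplex
import HarnessLib

/-!
# `β₁(k) = dim_k 𝔪/𝔪²` from ANY free resolution of the residue field, and `β₀(k) = 1`
# ([BrunsHerzog1998] §1.3; the local count in [MumfordAV1970] §13)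

Layer `Literature/Algebra/Homology`, namespace `Literature.Algebra.Homology`.  THEOREMS ONLY (Mathlib + ★ `HomComplexOfModule`;
no definition, no named fact, no instance, no notation, no `sorry`).  Brick **B3** of the duality-free «H1-DIM any characteristic»
cut of the DUAL-S road (cell hodgecm-mathlib, memo `MEMO-H1DIM-cut.v1.B-p04g40` §2; B1 ★ `AcyclicityLemmaRegularSequence`, B2 ★
`FreeComplexDualAcyclic`): the local-algebra count which turns «the dual `Hom_R(K•, R)` of the Grothendieck complex of the
Poincaré bundle over `R = 𝒪_{Â,0}` is a finite free resolution of `k`» into `dim_k H¹(A, 𝒪_A) = dim_k 𝔪/𝔪² = dim A`.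
HC_CM is proved only modulo the printed citations until rung 0 closes; this file discharges none of them.

## Mathematics

Let `(R, 𝔪, k)` be a local ring and `F₂ → F₁ → F₀ → k → 0` (`d₂`, `d₁`, `ε`) an exact sequence of `R`-modules with `F₀` FREE
(no minimality, no finiteness; `F₁`, `F₂` arbitrary) — the bottom of any free resolution of the residue field.  Applying
`Hom_R(−, k)` gives the complex of `k`-vector spaces `Hom_R(F₀, k) → Hom_R(F₁, k) → Hom_R(F₂, k)` (precomposition `d^* =
LinearMap.lcomp k k d`, `k`-linear for the `k`-structure of the target); write `Z := ker d₂^*`, `B := im d₁^*` (`B ≤ Z`).  Its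
cohomology `Z ⧸ B = Ext¹_R(k, k)` is realised below as the `k`-subspace `Z.map B.mkQ` of `Hom_R(F₁, k) ⧸ B` (the image of the
cocycles; this spelling avoids quotients of subtypes of `Hom`-spaces, whose instances Lean does not find).

* §1 `exists_lift_residue_comp_eq`: `ε` lifts through the free `F₀` to `f : F₀ → R` with `residue ∘ f = ε`, and there is
  `e ∈ F₀` with `f e = 1` (Mathlib `Module.projective_lifting_property`; units lift along `residue`).  Consequently
  `u ↦ (f u)·e − u` maps `F₀` into `ker ε = im d₁`, and `f ∘ d₁` maps `F₁` into `𝔪`.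
* §2 `nonempty_hom_maximalIdeal_linearEquiv_extOne`: the `k`-linear map `Θ : Hom_R(𝔪, k) → Hom_R(F₁, k)`, `χ ↦ (y ↦ χ(f(d₁ y)))`,
  lands in `Z` and induces a BIJECTION `Hom_R(𝔪, k) ≃ Z ⧸ B` (injective: a coboundary `φ₀ ∘ d₁` evaluated at `y` with `d₁ y = x·e`,
  `x ∈ 𝔪`, gives `x·φ₀(e) = 0`; surjective: a cocycle `φ` factors through `d₁ : F₁ ↠ im d₁` as `ψ`, and `φ − Θ(ψ ∘ (x ↦ x·e)) =
  (ψ ∘ (u ↦ (f u)·e − u)) ∘ d₁` is a coboundary).  Choice-free, no `Tor`, no comparison of resolutions.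
* §3 `nonempty_dual_cotangentSpace_linearEquiv_hom_maximalIdeal`: `Hom_R(𝔪, k) = Hom_R(𝔪/𝔪², k) = (𝔪/𝔪²)^*` (`Ideal.toCotangent`,
  `LinearMap.extendScalarsOfSurjective`); hence **`nonempty_extOne_linearEquiv_dual_cotangentSpace`**: `Z ⧸ B ≃ₗ[k] (𝔪/𝔪²)^*`
  and **`finrank_extOne_eq_finrank_cotangentSpace`**: `dim_k (Z ⧸ B) = dim_k 𝔪/𝔪²` for `R` noetherian (`β₁(k) = emb.dim R`,
  [BrunsHerzog1998] Prop. 1.3.1 ∕ Cor. 1.3.2: `βᵢ(k) = dim_k Torᵢ(k, k)`, `Extⁱ = Hⁱ(Hom_R(F•, k))` for any free resolution).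
* §4 `nonempty_extZero_linearEquiv_residueField`, `finrank_extZero_eq_one`: `ker d₁^* = k·ε ≃ₗ[k] k` (`β₀(k) = 1`).
* §5 the same statements in the COCHAIN dialect of ★ `HomComplexOfModule` ∕ ★ B2: for `F : CochainComplex (ModuleCat R) ℤ` with
  `F⁰` free, an augmentation `ε : F⁰ ↠ k` with `im(F⁻¹ → F⁰) = ker ε`, and `F.ExactAt (-1)`, the complex `Hom_R(F•, k) =
  homComplex F k` has differentials `lcomp k k d_F` on underlying maps (`homComplex_d_one_two_eq_lcomp`, `rfl`), and
  **`finrank_extOne_homComplex_eq_finrank_cotangentSpace`**: its degree-`1` cohomology has `k`-dimension `dim_k 𝔪/𝔪²` —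
  instantiated by the H1-DIM head at `F := homComplex K R`, the dual of the Grothendieck complex (★ B2 `homComplex_exactAt_of_neg`
  supplies `ExactAt (-1)`, brick B5 the augmentation `H⁰(Hom(K•, R)) = Q ≅ k`).

## References
* [BrunsHerzog1998] W. Bruns, J. Herzog, *Cohen–Macaulay rings*, rev. ed. (1998), §1.3 «Depth and projective dimension»,
  Prop. 1.3.1 and Cor. 1.3.2 (pp. 16–17): `βᵢ(M) = dim_k Torᵢ^R(M, k)`, `Extⁱ_R(M, k) = Hⁱ(Hom_R(F•, k))` for any free resolution.
* [MumfordAV1970] D. Mumford, *Abelian Varieties* (1970), §13 (pp. 125–130) («`dim H¹(X, 𝒪_X) = g`» through the complex `K•`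
  over `𝒪_{X̂,0}` and its dual).
* [EGAIII2] A. Grothendieck, *EGA III₂* (1963), (7.7.6) (the dual complex `Hom(K•, 𝒪)`).
-/

universe v u

open IsLocalRing Module

namespace Literature.Algebra.Homology

variable {R : Type u} [CommRing R] [IsLocalRing R]

/-! ## §1 The lift `f : F₀ → R` of the augmentation and the unit vector `e` -/

section Lift

variable {F₀ : Type v} [AddCommGroup F₀] [Module R F₀] [Module.Free R F₀]
  (ε : F₀ →ₗ[R] ResidueField R) (hε : Function.Surjective ε)

include hε in
/-- **Lift of the augmentation.** For `F₀` free and `ε : F₀ → k` onto there are `f : F₀ → R` with `residue ∘ f = ε` and `e ∈ F₀`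
with `f e = 1` (hence `ε e = 1`). [cite: BrunsHerzog1998, §1.3 Prop. 1.3.1 and Cor. 1.3.2 (pp. 16–17)] [cite: MumfordAV1970, §13 (pp. 125–130)] -/
theorem exists_lift_residue_comp_eq :
    ∃ (f : F₀ →ₗ[R] R) (e : F₀), (∀ u, residue R (f u) = ε u) ∧ f e = 1 := by
  have hπ : Function.Surjective (Algebra.linearMap R (ResidueField R)) := residue_surjective
  obtain ⟨f, hf⟩ := Module.projective_lifting_property (Algebra.linearMap R (ResidueField R)) ε hπ
  have hf' : ∀ u, residue R (f u) = ε u := fun u => by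
    simpa only [LinearMap.comp_apply, Algebra.linearMap_apply, ResidueField.algebraMap_eq] using LinearMap.congr_fun hf u
  obtain ⟨x₀, hx₀⟩ := hε 1
  have hu : IsUnit (f x₀) := (residue_ne_zero_iff_isUnit _).1 (by rw [hf', hx₀]; exact one_ne_zero)
  refine ⟨f, ((hu.unit⁻¹ : Rˣ) : R) • x₀, hf', ?_⟩
  rw [map_smul, smul_eq_mul, IsUnit.val_inv_mul]

end Lift

/-! ## §2 `Ext¹_R(k, k) ≅ Hom_R(𝔪, k)` from any free presentation `F₂ → F₁ → F₀ → k → 0` -/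

section ExtOne

variable {F₀ F₁ F₂ : Type v} [AddCommGroup F₀] [Module R F₀] [AddCommGroup F₁] [Module R F₁] [AddCommGroup F₂] [Module R F₂]
  [Module.Free R F₀]
  (d₂ : F₂ →ₗ[R] F₁) (d₁ : F₁ →ₗ[R] F₀) (ε : F₀ →ₗ[R] ResidueField R)
  (hε : Function.Surjective ε) (h₁ : Function.Exact d₁ ε) (h₂ : Function.Exact d₂ d₁)

include hε h₁ h₂ in
/-- **`Ext¹_R(k,k) ≅ Hom_R(𝔪, k)` from any free presentation.** With `Z = ker(d₂^* : Hom_R(F₁,k) → Hom_R(F₂,k))` and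
`B = im(d₁^* : Hom_R(F₀,k) → Hom_R(F₁,k))` (`k`-subspaces of `Hom_R(F₁,k)`), the image `Z.map B.mkQ` of the cocycles in
`Hom_R(F₁,k) ⧸ B` (= `Z ⧸ B`, as `B ≤ Z`) is `k`-isomorphic to `Hom_R(𝔪, k)`, via `χ ↦ (y ↦ χ (f (d₁ y)))` for a lift `f : F₀ → R`
of `ε` with `f e = 1`. [cite: BrunsHerzog1998, §1.3 Prop. 1.3.1 and Cor. 1.3.2 (pp. 16–17)] [cite: MumfordAV1970, §13 (pp. 125–130)] -/
theorem nonempty_hom_maximalIdeal_linearEquiv_extOne :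
    Nonempty
      ((↥(maximalIdeal R) →ₗ[R] ResidueField R) ≃ₗ[ResidueField R]
        ↥((LinearMap.ker (LinearMap.lcomp (ResidueField R) (ResidueField R) d₂)).map
          (LinearMap.range (LinearMap.lcomp (ResidueField R) (ResidueField R) d₁)).mkQ)) := by
  classical
  obtain ⟨f, e, hf, hfe⟩ := exists_lift_residue_comp_eq ε hε
  set Z := LinearMap.ker (LinearMap.lcomp (ResidueField R) (ResidueField R) d₂) with hZ
  set B := LinearMap.range (LinearMap.lcomp (ResidueField R) (ResidueField R) d₁) with hB
  -- basic consequences of exactness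
  have hd₁d₂ : ∀ z, d₁ (d₂ z) = 0 := fun z => (h₂ (d₂ z)).2 ⟨z, rfl⟩
  have hεd₁ : ∀ y, ε (d₁ y) = 0 := fun y => (h₁ (d₁ y)).2 ⟨y, rfl⟩
  have hεe : ε e = 1 := by rw [← hf, hfe, map_one]
  have hmem : ∀ y, f (d₁ y) ∈ maximalIdeal R := fun y => by
    rw [← residue_eq_zero_iff, hf]; exact hεd₁ y
  -- `(f u) • e - u ∈ ker ε = im d₁`, and `x • e ∈ im d₁` for `x ∈ 𝔪`
  have hproj : ∀ u : F₀, (f u) • e - u ∈ LinearMap.range d₁ := fun u => by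
    rw [← h₁.linearMap_ker_eq, LinearMap.mem_ker, map_sub, map_smul, hεe, Algebra.smul_def, mul_one,
      ResidueField.algebraMap_eq, hf, sub_self]
  have hge : ∀ x : ↥(maximalIdeal R), (x : R) • e ∈ LinearMap.range d₁ := fun x => by
    rw [← h₁.linearMap_ker_eq, LinearMap.mem_ker, map_smul, hεe, Algebra.smul_def, mul_one, ResidueField.algebraMap_eq,
      residue_eq_zero_iff]
    exact x.2
  -- the map `Θ χ = χ ∘ (f ∘ d₁)` and `Ψ = mkQ ∘ Θ`
  let fd : F₁ →ₗ[R] ↥(maximalIdeal R) := LinearMap.codRestrict (maximalIdeal R) (f ∘ₗ d₁) hmem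
  let Θ : (↥(maximalIdeal R) →ₗ[R] ResidueField R) →ₗ[ResidueField R] (F₁ →ₗ[R] ResidueField R) :=
    LinearMap.lcomp (ResidueField R) (ResidueField R) fd
  have hΘapply : ∀ χ y, Θ χ y = χ (fd y) := fun χ y => rfl
  have hfd₂ : ∀ z, fd (d₂ z) = 0 := fun z => by
    ext; simp only [fd, LinearMap.codRestrict_apply, LinearMap.comp_apply, hd₁d₂ z, map_zero, ZeroMemClass.coe_zero]
  have hΘZ : ∀ χ, Θ χ ∈ Z := fun χ => by
    rw [hZ, LinearMap.mem_ker, LinearMap.lcomp_apply']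
    ext z
    rw [LinearMap.comp_apply, hΘapply, hfd₂, map_zero, LinearMap.zero_apply]
  let Ψ : (↥(maximalIdeal R) →ₗ[R] ResidueField R) →ₗ[ResidueField R] ((F₁ →ₗ[R] ResidueField R) ⧸ B) := B.mkQ ∘ₗ Θ
  -- Ψ is injective
  have hinj : Function.Injective Ψ := by
    rw [injective_iff_map_eq_zero]
    intro χ hχ
    have hχB : Θ χ ∈ B := by
      simpa only [Ψ, LinearMap.comp_apply, Submodule.mkQ_apply, Submodule.Quotient.mk_eq_zero] using hχ
    obtain ⟨φ₀, hφ₀⟩ := hχB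
    ext x
    obtain ⟨y, hy⟩ := hge x
    have hfdy : fd y = x := by
      ext
      simp only [fd, LinearMap.codRestrict_apply, LinearMap.comp_apply, hy, map_smul, hfe, smul_eq_mul, mul_one]
    rw [← hfdy, ← hΘapply, ← hφ₀, LinearMap.lcomp_apply', LinearMap.comp_apply, hy, map_smul, Algebra.smul_def,
      ResidueField.algebraMap_eq, (residue_eq_zero_iff _).2 x.2, zero_mul, LinearMap.zero_apply]
  -- the range of Ψ is `Z.map B.mkQ`
  have hrange : LinearMap.range Ψ = Z.map B.mkQ := by
    apply le_antisymm
    · rintro _ ⟨χ, rfl⟩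
      exact ⟨Θ χ, hΘZ χ, rfl⟩
    · rintro _ ⟨φ, hφZ, rfl⟩
      have hφ : φ ∘ₗ d₂ = 0 := by
        simpa only [hZ, LinearMap.mem_ker, LinearMap.lcomp_apply', SetLike.mem_coe] using hφZ
      -- factor `φ` through `d₁' : F₁ ↠ im d₁`
      let d₁' : F₁ →ₗ[R] ↥(LinearMap.range d₁) := d₁.rangeRestrict
      have hd₁' : Function.Surjective d₁' := LinearMap.surjective_rangeRestrict d₁
      have hker : LinearMap.ker d₁' ≤ LinearMap.ker φ := by
        intro w hw
        rw [LinearMap.ker_rangeRestrict, h₂.linearMap_ker_eq] at hw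
        obtain ⟨w', rfl⟩ := hw
        exact LinearMap.congr_fun hφ w'
      let ψ : ↥(LinearMap.range d₁) →ₗ[R] ResidueField R :=
        (LinearMap.ker d₁').liftQ φ hker ∘ₗ (d₁'.quotKerEquivOfSurjective hd₁').symm.toLinearMap
      have hψ : ∀ y, ψ (d₁' y) = φ y := fun y => by
        simp only [ψ, LinearMap.comp_apply, LinearEquiv.coe_toLinearMap, LinearMap.quotKerEquivOfSurjective_symm_apply,
          Submodule.liftQ_apply]
      -- `χ := ψ ∘ (x ↦ x • e)`, `φ₀ := ψ ∘ (u ↦ (f u) • e - u)`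
      let gm : ↥(maximalIdeal R) →ₗ[R] ↥(LinearMap.range d₁) :=
        LinearMap.codRestrict (LinearMap.range d₁) (LinearMap.toSpanSingleton R F₀ e ∘ₗ (maximalIdeal R).subtype) hge
      let p : F₀ →ₗ[R] ↥(LinearMap.range d₁) :=
        LinearMap.codRestrict (LinearMap.range d₁) (LinearMap.toSpanSingleton R F₀ e ∘ₗ f - LinearMap.id) hproj
      refine ⟨ψ ∘ₗ gm, ?_⟩
      simp only [Ψ, LinearMap.comp_apply]
      rw [Submodule.mkQ_apply, Submodule.mkQ_apply, Submodule.Quotient.eq]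
      refine ⟨ψ ∘ₗ p, ?_⟩
      rw [LinearMap.lcomp_apply']
      ext y
      have hpy : p (d₁ y) = gm (fd y) - d₁' y := Subtype.ext (by
        simp only [p, gm, fd, d₁', LinearMap.codRestrict_apply, LinearMap.sub_apply, LinearMap.comp_apply,
          LinearMap.toSpanSingleton_apply, LinearMap.id_apply, Submodule.subtype_apply, AddSubgroupClass.coe_sub])
      rw [LinearMap.comp_apply, LinearMap.sub_apply, hΘapply, LinearMap.comp_apply, hpy, map_sub, hψ]
      rfl
  exact ⟨(LinearEquiv.ofInjective Ψ hinj).trans (LinearEquiv.ofEq _ _ hrange)⟩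

end ExtOne

/-! ## §3 `Hom_R(𝔪, k) = (𝔪/𝔪²)^*` and the Betti number `β₁(k) = dim_k 𝔪/𝔪²` -/

section Cotangent

/-- **`(𝔪/𝔪²)^* ≅ Hom_R(𝔪, k)`**: a `k`-linear functional on the cotangent space is the same as an `R`-linear map `𝔪 → k`
(every such map kills `𝔪² = 𝔪·𝔪`; Mathlib `Ideal.toCotangent`, `LinearMap.extendScalarsOfSurjective`).
[cite: BrunsHerzog1998, §1.3 Prop. 1.3.1 and Cor. 1.3.2 (pp. 16–17)] -/
theorem nonempty_dual_cotangentSpace_linearEquiv_hom_maximalIdeal :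
    Nonempty (Module.Dual (ResidueField R) (CotangentSpace R) ≃ₗ[ResidueField R] (↥(maximalIdeal R) →ₗ[R] ResidueField R)) := by
  let D : Module.Dual (ResidueField R) (CotangentSpace R) →ₗ[ResidueField R] (↥(maximalIdeal R) →ₗ[R] ResidueField R) :=
    { toFun := fun l => l.restrictScalars R ∘ₗ (maximalIdeal R).toCotangent
      map_add' := fun l l' => by ext; rfl
      map_smul' := fun c l => by ext; rfl }
  have hD : ∀ l x, D l x = l ((maximalIdeal R).toCotangent x) := fun l x => rfl
  refine ⟨LinearEquiv.ofBijective D ⟨?_, ?_⟩⟩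
  · rw [injective_iff_map_eq_zero]
    intro l hl
    ext v
    obtain ⟨x, rfl⟩ := Ideal.toCotangent_surjective _ v
    rw [← hD, hl, LinearMap.zero_apply, LinearMap.zero_apply]
  · intro χ
    have hle : (maximalIdeal R • ⊤ : Submodule R ↥(maximalIdeal R)) ≤ LinearMap.ker χ :=
      Submodule.smul_le.2 fun r hr n _ => by
        rw [LinearMap.mem_ker, map_smul, Algebra.smul_def, ResidueField.algebraMap_eq, (residue_eq_zero_iff r).2 hr, zero_mul]
    let χ' : CotangentSpace R →ₗ[R] ResidueField R := (maximalIdeal R • ⊤ : Submodule R ↥(maximalIdeal R)).liftQ χ hle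
    have hχ' : ∀ x, χ' ((maximalIdeal R).toCotangent x) = χ x := fun x => by
      rw [Ideal.toCotangent_apply]; exact Submodule.liftQ_apply _ _ _
    have hsurj : Function.Surjective (algebraMap R (ResidueField R)) := residue_surjective
    refine ⟨χ'.extendScalarsOfSurjective hsurj, ?_⟩
    ext x
    rw [hD, LinearMap.extendScalarsOfSurjective_apply, hχ']

variable {F₀ F₁ F₂ : Type v} [AddCommGroup F₀] [Module R F₀] [AddCommGroup F₁] [Module R F₁] [AddCommGroup F₂] [Module R F₂]
  [Module.Free R F₀]
  (d₂ : F₂ →ₗ[R] F₁) (d₁ : F₁ →ₗ[R] F₀) (ε : F₀ →ₗ[R] ResidueField R)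
  (hε : Function.Surjective ε) (h₁ : Function.Exact d₁ ε) (h₂ : Function.Exact d₂ d₁)

include hε h₁ h₂ in
/-- **`Ext¹_R(k, k) ≅ (𝔪/𝔪²)^*` from ANY free presentation** `F₂ → F₁ → F₀ → k → 0` (`F₀` free): the degree-one cohomology
`Z ⧸ B` of `Hom_R(F₀,k) → Hom_R(F₁,k) → Hom_R(F₂,k)` (realised as the image `Z.map B.mkQ` of the cocycles in `Hom_R(F₁,k) ⧸ B`)
is `k`-isomorphic to the dual of the cotangent space. [cite: BrunsHerzog1998, §1.3 Prop. 1.3.1 and Cor. 1.3.2 (pp. 16–17)] [cite: MumfordAV1970, §13 (pp. 125–130)] -/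
theorem nonempty_extOne_linearEquiv_dual_cotangentSpace :
    Nonempty
      (↥((LinearMap.ker (LinearMap.lcomp (ResidueField R) (ResidueField R) d₂)).map
          (LinearMap.range (LinearMap.lcomp (ResidueField R) (ResidueField R) d₁)).mkQ) ≃ₗ[ResidueField R]
        Module.Dual (ResidueField R) (CotangentSpace R)) := by
  obtain ⟨e₁⟩ := nonempty_hom_maximalIdeal_linearEquiv_extOne d₂ d₁ ε hε h₁ h₂
  obtain ⟨e₂⟩ := nonempty_dual_cotangentSpace_linearEquiv_hom_maximalIdeal (R := R)
  exact ⟨e₁.symm.trans e₂.symm⟩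

include hε h₁ h₂ in
/-- **`β₁(k) = dim_k 𝔪/𝔪²` (the embedding dimension), computed from ANY free presentation of `k`** over a noetherian local
ring: `dim_k (ker d₂^* ⧸ im d₁^*) = dim_k 𝔪/𝔪²`. [cite: BrunsHerzog1998, §1.3 Prop. 1.3.1 and Cor. 1.3.2 (pp. 16–17)] [cite: MumfordAV1970, §13 (pp. 125–130)] -/
theorem finrank_extOne_eq_finrank_cotangentSpace [IsNoetherianRing R] :
    Module.finrank (ResidueField R)
        ↥((LinearMap.ker (LinearMap.lcomp (ResidueField R) (ResidueField R) d₂)).map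
          (LinearMap.range (LinearMap.lcomp (ResidueField R) (ResidueField R) d₁)).mkQ) =
      Module.finrank (ResidueField R) (CotangentSpace R) := by
  obtain ⟨e⟩ := nonempty_extOne_linearEquiv_dual_cotangentSpace d₂ d₁ ε hε h₁ h₂
  rw [e.finrank_eq, Subspace.dual_finrank_eq]

end Cotangent

/-! ## §4 `β₀(k) = 1`: `Hom_R(k, k) = ker(d₁^*) ≅ k` -/

section ExtZero

variable {F₀ F₁ : Type v} [AddCommGroup F₀] [Module R F₀] [AddCommGroup F₁] [Module R F₁] [Module.Free R F₀]
  (d₁ : F₁ →ₗ[R] F₀) (ε : F₀ →ₗ[R] ResidueField R) (hε : Function.Surjective ε) (h₁ : Function.Exact d₁ ε)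

include hε h₁ in
/-- **`β₀(k) = 1`**: for a free presentation `F₁ → F₀ → k → 0`, the cocycles `ker(d₁^* : Hom_R(F₀,k) → Hom_R(F₁,k))` are the
line `k·ε` — evaluation at a vector `e` with `ε e = 1` is a `k`-isomorphism onto `k`. [cite: BrunsHerzog1998, §1.3 Prop. 1.3.1 and Cor. 1.3.2 (pp. 16–17)] -/
theorem nonempty_extZero_linearEquiv_residueField :
    Nonempty (↥(LinearMap.ker (LinearMap.lcomp (ResidueField R) (ResidueField R) d₁)) ≃ₗ[ResidueField R] ResidueField R) := by
  obtain ⟨f, e, hf, hfe⟩ := exists_lift_residue_comp_eq ε hε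
  have hεe : ε e = 1 := by rw [← hf, hfe, map_one]
  have hproj : ∀ u : F₀, (f u) • e - u ∈ LinearMap.range d₁ := fun u => by
    rw [← h₁.linearMap_ker_eq, LinearMap.mem_ker, map_sub, map_smul, hεe, Algebra.smul_def, mul_one,
      ResidueField.algebraMap_eq, hf, sub_self]
  let ev : (F₀ →ₗ[R] ResidueField R) →ₗ[ResidueField R] ResidueField R :=
    { toFun := fun φ => φ e, map_add' := fun _ _ => rfl, map_smul' := fun _ _ => rfl }
  let E := ev ∘ₗ (LinearMap.ker (LinearMap.lcomp (ResidueField R) (ResidueField R) d₁)).subtype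
  have hE : ∀ φ, E φ = (φ : F₀ →ₗ[R] ResidueField R) e := fun φ => rfl
  refine ⟨LinearEquiv.ofBijective E ⟨?_, ?_⟩⟩
  · rw [injective_iff_map_eq_zero]
    intro φ hφ
    have hφd : (φ : F₀ →ₗ[R] ResidueField R) ∘ₗ d₁ = 0 := by
      have := φ.2; rwa [LinearMap.mem_ker, LinearMap.lcomp_apply'] at this
    apply Subtype.ext
    ext u
    obtain ⟨y, hy⟩ := hproj u
    have hu : u = (f u) • e - d₁ y := by rw [hy, sub_sub_cancel]
    rw [hE] at hφ
    rw [hu, map_sub, map_smul, hφ, smul_zero, ← LinearMap.comp_apply, hφd, LinearMap.zero_apply, sub_zero,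
      Submodule.coe_zero, LinearMap.zero_apply]
  · intro c
    have hεmem : ε ∈ LinearMap.ker (LinearMap.lcomp (ResidueField R) (ResidueField R) d₁) := by
      rw [LinearMap.mem_ker, LinearMap.lcomp_apply']; exact h₁.linearMap_comp_eq_zero
    refine ⟨c • ⟨ε, hεmem⟩, ?_⟩
    rw [map_smul, hE, hεe, smul_eq_mul, mul_one]

include hε h₁ in
/-- **`β₀(k) = 1`** as a dimension count. [cite: BrunsHerzog1998, §1.3 Prop. 1.3.1 and Cor. 1.3.2 (pp. 16–17)] -/
theorem finrank_extZero_eq_one :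
    Module.finrank (ResidueField R) ↥(LinearMap.ker (LinearMap.lcomp (ResidueField R) (ResidueField R) d₁)) = 1 := by
  obtain ⟨e⟩ := nonempty_extZero_linearEquiv_residueField d₁ ε hε h₁
  rw [e.finrank_eq, Module.finrank_self]

end ExtZero

/-! ## §5 Cochain dialect (★ `HomComplexOfModule`, ★ B2 `FreeComplexDualAcyclic`) -/

section Complex

variable (F : CochainComplex (ModuleCat.{u} R) ℤ)

/-- The differential `Hom_R(F⁻¹, k) → Hom_R(F⁻², k)` of `homComplex F k` in degrees `1 → 2` is precomposition with
`d_F : F⁻² → F⁻¹`, i.e. the `k`-linear `LinearMap.lcomp k k d_F` on underlying functions (★ `homComplex_d_apply`).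
[cite: EGAIII2, (7.7.6)] [cite: BrunsHerzog1998, §1.1 (p. 4)] -/
theorem homComplex_d_one_two_eq_lcomp (φ : F.X (-1) →ₗ[R] ResidueField R) :
    ((homComplex F (ResidueField R)).d 1 2).hom φ =
      LinearMap.lcomp (ResidueField R) (ResidueField R) (F.d (-2) (-1)).hom φ := rfl

/-- The differential `Hom_R(F⁰, k) → Hom_R(F⁻¹, k)` of `homComplex F k` in degrees `0 → 1` is `LinearMap.lcomp k k d_F^{-1,0}`
on underlying functions (★ `homComplex_d_apply`). [cite: EGAIII2, (7.7.6)] [cite: BrunsHerzog1998, §1.1 (p. 4)] -/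
theorem homComplex_d_zero_one_eq_lcomp (φ : F.X 0 →ₗ[R] ResidueField R) :
    ((homComplex F (ResidueField R)).d 0 1).hom φ =
      LinearMap.lcomp (ResidueField R) (ResidueField R) (F.d (-1) 0).hom φ := rfl

variable [Module.Free R (F.X 0)]
  (ε : F.X 0 →ₗ[R] ResidueField R) (hε : Function.Surjective ε) (h₁ : Function.Exact (F.d (-1) 0).hom ε)
  (h₂ : F.ExactAt (-1))

include hε h₁ h₂ in
/-- **`dim_k H¹(Hom_R(F•, k)) = dim_k 𝔪/𝔪²` for a complex `F•` resolving `k` at degree `0`** (cochain spelling: `F⁰` free,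
`ε : F⁰ ↠ k` with `im(F⁻¹ → F⁰) = ker ε`, `F` exact at `-1`; e.g. `F = Hom_R(K•, R)` the dual of the Grothendieck complex of the
Poincaré bundle, ★ B2 `homComplex_exactAt_of_neg`): the degree-`1` cohomology of `homComplex F k` — cocycles
`ker(lcomp d_F^{-2,-1})` modulo coboundaries `im(lcomp d_F^{-1,0})`, as `k`-spaces — has dimension `dim_k 𝔪/𝔪²`.
[cite: MumfordAV1970, §13 (pp. 125–130)] [cite: BrunsHerzog1998, §1.3 Prop. 1.3.1 and Cor. 1.3.2 (pp. 16–17)] [cite: EGAIII2, (7.7.6)] -/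
theorem finrank_extOne_homComplex_eq_finrank_cotangentSpace [IsNoetherianRing R] :
    Module.finrank (ResidueField R)
        ↥((LinearMap.ker (LinearMap.lcomp (ResidueField R) (ResidueField R) (F.d (-2) (-1)).hom)).map
          (LinearMap.range (LinearMap.lcomp (ResidueField R) (ResidueField R) (F.d (-1) 0).hom)).mkQ) =
      Module.finrank (ResidueField R) (CotangentSpace R) := by
  have h₂' : Function.Exact (F.d (-2) (-1)).hom (F.d (-1) 0).hom := by
    have := (F.exactAt_iff' (-2) (-1) 0 (by simp) (by simp)).1 h₂
    rwa [CategoryTheory.ShortComplex.ShortExact.moduleCat_exact_iff_function_exact] at this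
  exact finrank_extOne_eq_finrank_cotangentSpace (F.d (-2) (-1)).hom (F.d (-1) 0).hom ε hε h₁ h₂'

include hε h₁ h₂ in
/-- The same with the `k`-linear identification made explicit: `H¹(Hom_R(F•, k)) ≃ₗ[k] (𝔪/𝔪²)^*` (no noetherian hypothesis).
[cite: MumfordAV1970, §13 (pp. 125–130)] [cite: BrunsHerzog1998, §1.3 Prop. 1.3.1 and Cor. 1.3.2 (pp. 16–17)] -/
theorem nonempty_extOne_homComplex_linearEquiv_dual_cotangentSpace :
    Nonempty
      (↥((LinearMap.ker (LinearMap.lcomp (ResidueField R) (ResidueField R) (F.d (-2) (-1)).hom)).map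
          (LinearMap.range (LinearMap.lcomp (ResidueField R) (ResidueField R) (F.d (-1) 0).hom)).mkQ) ≃ₗ[ResidueField R]
        Module.Dual (ResidueField R) (CotangentSpace R)) := by
  have h₂' : Function.Exact (F.d (-2) (-1)).hom (F.d (-1) 0).hom := by
    have := (F.exactAt_iff' (-2) (-1) 0 (by simp) (by simp)).1 h₂
    rwa [CategoryTheory.ShortComplex.ShortExact.moduleCat_exact_iff_function_exact] at this
  exact nonempty_extOne_linearEquiv_dual_cotangentSpace (F.d (-2) (-1)).hom (F.d (-1) 0).hom ε hε h₁ h₂'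

include hε h₁ in
/-- **`dim_k H⁰(Hom_R(F•, k)) = 1`** in the cochain spelling (cocycles `ker(lcomp d_F^{-1,0}) ⊆ Hom_R(F⁰, k)`; the complex
`homComplex F k` has nothing in degree `-1` when `F¹ = 0`). [cite: BrunsHerzog1998, §1.3 Prop. 1.3.1 and Cor. 1.3.2 (pp. 16–17)] -/
theorem finrank_extZero_homComplex_eq_one :
    Module.finrank (ResidueField R)
        ↥(LinearMap.ker (LinearMap.lcomp (ResidueField R) (ResidueField R) (F.d (-1) 0).hom)) = 1 :=
  finrank_extZero_eq_one (F.d (-1) 0).hom ε hε h₁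

end Complex

end Literature.Algebra.Homology
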